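import Literature.Probability.RandomPlanarGeometry.TangentAtSLE6Proofs
import Literature.Probability.RandomPlanarGeometry.CurveClassStopAtMeasurable
import HarnessLib

/-!
# Tangent vectors of local / target-independent chordal families are local / target independent
# to first order

Companion of `TangentAtSLE6.lean` / `TangentAtSLE6Proofs.lean` (definition item `defn-TangentAtSLE6`,
route CardyAnchoredRigidity of `CriticalPhenomena/CardyFormulaZ2`; serves its informal items
GermSignLemma and SectorExhaustion, whose arguments use the linearised locality and splitting
clauses of a tangent vector at SLE₆), theorems only:

* `measurable_of_mem_smoothExitCylinders` — the test observables of D1 (smooth cylinder functions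
  of finitely many exit points from balls) are Borel: `CurveClass.stopAt F` is Borel for closed
  `F` (`CurveClass.measurable_stopAt`, Suslin) and `CurveClass.target` is continuous;
* `ChordalFamily.coord_eq_of_isLocal` — LOCALITY AT THE LEVEL OF COORDINATES: for a chordal family
  that is local in the restriction form (`ChordalFamily.IsLocal`, LSW 2001 Cor. 2.4) and Dobrushin
  domains `D' ⊆ D` with the same marked points, `∫ f d(P D') = ∫ f d(P D)` for every Borel
  observable `f` of the curve stopped on `closure (D ∖ D')` (the two stopped laws coincide as
  measures, `map_stopAt_eq_of_isLocal`, and a.e. curve starts at `a`, where `f = f ∘ stopAt`);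
* `ChordalFamily.coord_chord_eq_of_isTargetIndependent` — the same for the splitting form
  (`ChordalFamily.IsTargetIndependent`, LSW 2001 Cor. 2.3 / Werner 2007 Prop. 3.4): in
  `(D; a, b, b')` the laws from `a` to `b` and from `a` to `b'` give the same integral to every
  Borel observable of the curve stopped on the arc `[b, b']`;
* differentiating coordinates that agree near `ε = 0`: `velocity_isLocal`,
  `velocity_isTargetIndependent` (the linearised clauses `Deformation.IsLocal`,
  `Deformation.IsTargetIndependent` hold for velocities of curves of local, resp. target
  independent, chordal families, along any test class of Borel observables), the tangent-cone
  forms `isLocal_of_mem_tangentCone`, `isTargetIndependent_of_mem_tangentCone`, and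
  `isLocal_and_isTargetIndependent_of_mem_tangentAtSLE6`: together with
  `linearised_of_mem_tangentAtSLE6` every `v ∈ TangentAtSLE6 mirrorLocalMarkovClass` satisfies
  five of the six linearised axioms of `TangentAtSLE6.lean` as theorems (all but the set-Markov
  linearisation, which involves the extension `Q`).

Sources: G. Lawler, O. Schramm, W. Werner, Acta Math. 187 (2001) §2, Cor. 2.3–2.4 (the two forms of
locality being differentiated); W. Werner, *Lectures on two-dimensional critical percolation*
(2007) §3.2, Prop. 3.4. Mathlib: `MeasureTheory.integral_map`, `Measure.map_apply`,
`Filter.EventuallyEq.deriv_eq`, `Measurable.stronglyMeasurable`. Tree: `TangentAtSLE6` (all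
notions), `CurveClass.measurable_stopAt` (CurveClassStopAtMeasurable), `CurveClass.continuous_target`
(CurveSpace), `MarkedDomain.isClosed_arc`, `MarkedDomain.pt_chord_zero` (PlanarDomains).
-/

noncomputable section

open Set MeasureTheory Topology Filter
open scoped NNReal ENNReal

namespace Literature.Probability.RandomPlanarGeometry

/-! ### The test observables are Borel -/

/-- The exit point from a ball is a Borel function of the curve class (`stopAt` of the closed
complement of the ball is Borel, `target` is continuous). [folklore] -/
theorem CurveClass.measurable_exitPoint (z : ℂ) (r : ℝ) :
    Measurable (CurveClass.exitPoint z r : CurveClass ℂ → ℂ) :=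
  CurveClass.continuous_target.measurable.comp
    (CurveClass.measurable_stopAt Metric.isOpen_ball.isClosed_compl)

/-- A `C_b^∞` function is continuous. [folklore] -/
theorem IsSmoothBounded.continuous {n : ℕ} {φ : (Fin n → ℂ) → ℝ} (h : IsSmoothBounded φ) :
    Continuous φ :=
  h.1.continuous

/-- **Smooth exit cylinders are Borel observables.** [folklore] -/
theorem measurable_of_mem_smoothExitCylinders {f : CurveClass ℂ → ℝ}
    (hf : f ∈ smoothExitCylinders) : Measurable f := by
  obtain ⟨n, z, r, φ, -, hφ, rfl⟩ := hf
  exact hφ.continuous.measurable.comp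
    (measurable_pi_lambda _ fun i => CurveClass.measurable_exitPoint (z i) (r i))

namespace ChordalFamily

/-! ### Locality (restriction form) at the level of coordinates -/

section Locality

variable {P : ChordalFamily} {D D' : DobrushinDomain}

/-- For a local family and `D' ⊆ D` with the same marked points, the laws of the curves of
`P D'` and `P D` stopped on `closure (D ∖ D')` coincide AS MEASURES (the axiom states equality on
Borel sets; `stopAt` is Borel). LSW 2001 Cor. 2.4. [folklore] -/
theorem map_stopAt_eq_of_isLocal (hP : P.IsLocal) (hsub : D'.carrier ⊆ D.carrier)
    (h0 : D'.pt 0 = D.pt 0) (h1 : D'.pt 1 = D.pt 1) :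
    (P D').map (CurveClass.stopAt (closure (D.carrier \ D'.carrier))) =
      (P D).map (CurveClass.stopAt (closure (D.carrier \ D'.carrier))) := by
  have hm : Measurable
      (CurveClass.stopAt (closure (D.carrier \ D'.carrier)) : CurveClass ℂ → CurveClass ℂ) :=
    CurveClass.measurable_stopAt isClosed_closure
  ext T hT
  rw [Measure.map_apply hm hT, Measure.map_apply hm hT]
  exact hP D D' hsub h0 h1 T hT

/-- For a chordal family, the coordinate of a Borel observable of the curve STOPPED on the closed
set `F` (one with `f (γ.stopAt F) = f γ` for curves from `a`) in a domain with first marked point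
`a` is the integral of `f` against the stopped law. [folklore] -/
theorem coord_eq_integral_map_stopAt (hc : P.IsChordal) {F : Set ℂ} (hF : IsClosed F)
    {a : ℂ} (E : DobrushinDomain) (hE : E.pt 0 = a) {f : CurveClass ℂ → ℝ} (hf : Measurable f)
    (hstop : ∀ γ : CurveClass ℂ, γ.source = a → f (γ.stopAt F) = f γ) :
    coord P E f = ∫ γ, f γ ∂((P E).map (CurveClass.stopAt F)) := by
  rw [integral_map (CurveClass.measurable_stopAt hF).aemeasurable
    hf.stronglyMeasurable.aestronglyMeasurable, coord]
  refine integral_congr_ae ?_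
  filter_upwards [(hc E).2] with γ hγ
  exact (hstop γ (hγ.1.trans hE)).symm

/-- **Locality at the level of coordinates.** For a chordal family local in the restriction form
and Dobrushin domains `D' ⊆ D` with the same marked points, every Borel observable of the curve
stopped on `closure (D ∖ D')` has the same integral under `P D'` and `P D`.
LSW 2001 Cor. 2.4. [folklore] -/
theorem coord_eq_of_isLocal (hP : P.IsLocal) (hc : P.IsChordal) (hsub : D'.carrier ⊆ D.carrier)
    (h0 : D'.pt 0 = D.pt 0) (h1 : D'.pt 1 = D.pt 1) {f : CurveClass ℂ → ℝ} (hf : Measurable f)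
    (hstop : ∀ γ : CurveClass ℂ, γ.source = D.pt 0 →
      f (γ.stopAt (closure (D.carrier \ D'.carrier))) = f γ) :
    coord P D' f = coord P D f := by
  rw [coord_eq_integral_map_stopAt hc isClosed_closure D' h0 hf hstop,
    coord_eq_integral_map_stopAt hc isClosed_closure D rfl hf hstop,
    map_stopAt_eq_of_isLocal hP hsub h0 h1]

end Locality

/-! ### Target independence (splitting form) at the level of coordinates -/

section Splitting

variable {P : ChordalFamily}

/-- For a target independent family, in `(D; a, b, b')` the laws of the curves from `a` to `b`
and from `a` to `b'` stopped on the arc `[b, b']` coincide as measures.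
LSW 2001 Cor. 2.3 / Werner 2007 Prop. 3.4. [folklore] -/
theorem map_stopAt_arc_eq_of_isTargetIndependent (hP : P.IsTargetIndependent)
    (D : MarkedDomain 3) :
    (P (D.chord 0 1 (by decide))).map (CurveClass.stopAt (D.arc 1)) =
      (P (D.chord 0 2 (by decide))).map (CurveClass.stopAt (D.arc 1)) := by
  have hm : Measurable (CurveClass.stopAt (D.arc 1) : CurveClass ℂ → CurveClass ℂ) :=
    CurveClass.measurable_stopAt (D.isClosed_arc 1)
  ext T hT
  rw [Measure.map_apply hm hT, Measure.map_apply hm hT]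
  exact hP D T hT

/-- **Target independence at the level of coordinates.** For a chordal, target independent family,
every Borel observable of the curve stopped on the arc `[b, b']` has the same integral under the
law from `a` to `b` and the law from `a` to `b'`. LSW 2001 Cor. 2.3. [folklore] -/
theorem coord_chord_eq_of_isTargetIndependent (hP : P.IsTargetIndependent) (hc : P.IsChordal)
    (D : MarkedDomain 3) {f : CurveClass ℂ → ℝ} (hf : Measurable f)
    (hstop : ∀ γ : CurveClass ℂ, γ.source = D.pt 0 → f (γ.stopAt (D.arc 1)) = f γ) :
    coord P (D.chord 0 1 (by decide)) f = coord P (D.chord 0 2 (by decide)) f := by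
  rw [coord_eq_integral_map_stopAt hc (D.isClosed_arc 1) (D.chord 0 1 (by decide))
      (D.pt_chord_zero 0 1 _) hf hstop,
    coord_eq_integral_map_stopAt hc (D.isClosed_arc 1) (D.chord 0 2 (by decide))
      (D.pt_chord_zero 0 2 _) hf hstop,
    map_stopAt_arc_eq_of_isTargetIndependent hP D]

end Splitting

/-! ### The linearised clauses for velocities and tangent vectors -/

section Velocity

variable {𝒯 : Set (CurveClass ℂ → ℝ)} {c : ℝ → ChordalFamily}

/-- **Velocities of local chordal curves are local to first order.** If the families `c ε` are
chordal and local (restriction form) for all small `|ε|`, the velocity of `c` along a test class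
of Borel observables satisfies `Deformation.IsLocal`: the two coordinates being differentiated
agree near `0`. LSW 2001 Cor. 2.4, differentiated. [folklore] -/
theorem velocity_isLocal (h𝒯 : ∀ f ∈ 𝒯, Measurable f)
    (h : ∀ᶠ ε in 𝓝 (0 : ℝ), (c ε).IsLocal ∧ (c ε).IsChordal) :
    (velocity 𝒯 c).IsLocal 𝒯 := by
  intro D D' hsub h0 h1 f hf hstop
  rw [velocity_apply_of_mem c D' hf, velocity_apply_of_mem c D hf]
  refine Filter.EventuallyEq.deriv_eq ?_
  filter_upwards [h] with ε hε
  exact coord_eq_of_isLocal hε.1 hε.2 hsub h0 h1 (h𝒯 f hf) hstop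

/-- **Velocities of target independent chordal curves are target independent to first order**
(`Deformation.IsTargetIndependent`). LSW 2001 Cor. 2.3, differentiated. [folklore] -/
theorem velocity_isTargetIndependent (h𝒯 : ∀ f ∈ 𝒯, Measurable f)
    (h : ∀ᶠ ε in 𝓝 (0 : ℝ), (c ε).IsTargetIndependent ∧ (c ε).IsChordal) :
    (velocity 𝒯 c).IsTargetIndependent 𝒯 := by
  intro D f hf hstop
  rw [velocity_apply_of_mem c _ hf, velocity_apply_of_mem c _ hf]
  refine Filter.EventuallyEq.deriv_eq ?_
  filter_upwards [h] with ε hε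
  exact coord_chord_eq_of_isTargetIndependent hε.1 hε.2 D (h𝒯 f hf) hstop

variable {𝒞 : Set ChordalFamily} {P₀ : ChordalFamily} {v : Deformation}

/-- Every tangent vector of a class of local chordal families, along a test class of Borel
observables, is local to first order. [folklore] -/
theorem isLocal_of_mem_tangentCone (h𝒞 : ∀ P ∈ 𝒞, P.IsLocal ∧ P.IsChordal)
    (h𝒯 : ∀ f ∈ 𝒯, Measurable f) (hv : v ∈ tangentCone 𝒞 P₀ 𝒯) : v.IsLocal 𝒯 := by
  obtain ⟨c, hc, rfl⟩ := hv
  exact velocity_isLocal h𝒯 (hc.eventually_mem.mono fun ε hε => h𝒞 _ hε)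

/-- Every tangent vector of a class of target independent chordal families, along a test class of
Borel observables, is target independent to first order. [folklore] -/
theorem isTargetIndependent_of_mem_tangentCone
    (h𝒞 : ∀ P ∈ 𝒞, P.IsTargetIndependent ∧ P.IsChordal) (h𝒯 : ∀ f ∈ 𝒯, Measurable f)
    (hv : v ∈ tangentCone 𝒞 P₀ 𝒯) : v.IsTargetIndependent 𝒯 := by
  obtain ⟨c, hc, rfl⟩ := hv
  exact velocity_isTargetIndependent h𝒯 (hc.eventually_mem.mono fun ε hε => h𝒞 _ hε)

end Velocity

/-- **Tangent vectors at SLE₆ inside `mirrorLocalMarkovClass` are local and target independent to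
first order** (with `linearised_of_mem_tangentAtSLE6`: chordal, similarity covariant, mirror
covariant, local and target independent — five of the six linearised axioms as theorems).
[folklore] -/
theorem isLocal_and_isTargetIndependent_of_mem_tangentAtSLE6 {v : Deformation}
    (hv : v ∈ TangentAtSLE6 mirrorLocalMarkovClass) :
    v.IsLocal smoothExitCylinders ∧ v.IsTargetIndependent smoothExitCylinders := by
  obtain ⟨P₀, -, hv⟩ := hv
  exact ⟨isLocal_of_mem_tangentCone (fun P hP => ⟨hP.1.isLocal, hP.1.isChordal⟩)
      (fun f hf => measurable_of_mem_smoothExitCylinders hf) hv,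
    isTargetIndependent_of_mem_tangentCone
      (fun P hP => ⟨hP.1.targetIndependent, hP.1.isChordal⟩)
      (fun f hf => measurable_of_mem_smoothExitCylinders hf) hv⟩

end ChordalFamily

end Literature.Probability.RandomPlanarGeometry
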